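import Summits.HubbardSuperconductivity.HubbardSuperconductivity.Theorems.TwSeededEnsembleEquivalence.Negative.DefectFloor

/-!
# Crux `TwSeededEnsembleEquivalenceR` (stmt-HubbardSuperconductivity-15581) — the entropy allowance is load-bearing

Negative-side support lemmas (refuter, cdisprove gen 1 on the REPAIRED thermal-window crux of route
`ThermalWedge`), sorry-free and definition-free.

The repaired crux reads: for `δ ∈ [1/10,2/5]` there are a window `−4 < μ₁ ≤ μ₂ < 0` and `a, K', U₀ > 0`
such that for `0 < U ≤ U₀`, every seed `g ∈ [K'U, 1/10]` and every `1 ≤ β ≤ e^{a/U}` some `μ ∈ [μ₁,μ₂]`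
has, eventually in `L`,
`D_L(β,μ;U,g) := e_L(g) + p_L(β,μ,U,g) − μ N_L/L² ≤ log 4/β + ε`.

TEMPLATE H of the standing disprover of the predecessor crux (stmt-1698, `Negative/DefectFloor.lean`,
`seeded_defect_floor_crux`) bounds the defect functional BELOW, uniformly in `L ≥ 3`:
`D_L(β,μ;U,g) ≥ (2/β) log(1 + e^{−8β}) − U − 32g` (`|μ| ≤ 4`, `U, g ≥ 0`). The new quantifier shape
(thermal window `β ≤ e^{a/U}`, seed floor `g ≥ K'U`, exponent `a` and floor constant `K'` chosen by the
prover AFTER `δ`) does not protect the allowance: the disprover answers any `(a, K', U₀)` with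
`U → 0⁺` small enough that (i) `β₀ ≤ e^{a/U}`, (ii) the smallest admissible seed `g = K'U` is below `c/128`,
and evaluates the floor at `β = β₀`.

* `twSeededEnsembleEquivalenceR_false_of_allowance_lt` — KILL FORM: the variant of the repaired crux with
  ANY allowance `A(β)` in place of `log 4/β` is false as soon as `A(β₀) < (2/β₀) log(1 + e^{−8β₀})` at one
  `β₀ ≥ 1`.
* `twSeededEnsembleEquivalenceR_false_without_allowance` — the repaired crux with the allowance dropped
  (right-hand side `ε` alone) is FALSE: any proof of `TwSeededEnsembleEquivalenceR` must spend the
  `log 4/β` allowance; in particular no argument that proves "exact" thermal-window ensemble equivalence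
  `D_L → 0` can exist (the free thermal entropy is in the way at every finite `β`).

Calibration (landed with Template H, `defect_floor_lt_allowance`): `(2/β) log(1 + e^{−8β}) < log 4/β` for
every `β > 0`, so the floor refutes no instance of the crux itself.
-/

set_option linter.dupNamespace false

namespace Summit.HubbardSuperconductivity.HubbardSuperconductivity.Theorems.TwSeededEnsembleEquivalenceR.Negative

open Matrix Literature.MathematicalPhysics.QuantumLattice
open Summit.HubbardSuperconductivity.HubbardSuperconductivity.Theorems.TwSeededEnsembleEquivalence.Negative
open scoped ComplexOrder Matrix.Norms.L2Operator

noncomputable section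

/-- **Any allowance below the thermal floor is refuted (repaired crux shape).** If
`A(β₀) < (2/β₀) log(1 + e^{−8β₀})` at some `β₀ ≥ 1`, the variant of `TwSeededEnsembleEquivalenceR` with
entropy allowance `A(β)` in place of `log 4/β` is FALSE. Witness against any `(μ₁,μ₂,a,K',U₀)`: `δ = 1/10`,
`β = β₀`, `U = min U₀ (min (c/4) (min (c/(128K')) (min (1/(10K')) (a/(log β₀ + 1)))))`, `g = K'U`,
`ε = c/4`, `L = max L₀ 3`, where `c > 0` is the gap below the floor. [folklore] -/
theorem twSeededEnsembleEquivalenceR_false_of_allowance_lt (A : ℝ → ℝ) {β₀ : ℝ} (hβ₀ : 1 ≤ β₀)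
    (hA : A β₀ < 2 / β₀ * Real.log (1 + Real.exp (-(8 * β₀)))) :
    ¬ (∀ δ ∈ Set.Icc (1/10 : ℝ) (2/5 : ℝ), ∃ μ₁ μ₂ : ℝ, -4 < μ₁ ∧ μ₁ ≤ μ₂ ∧ μ₂ < 0 ∧
        ∃ a K' U₀ : ℝ, 0 < a ∧ 0 < K' ∧ 0 < U₀ ∧ ∀ U ∈ Set.Ioc (0 : ℝ) U₀, ∀ g ∈ Set.Icc (K' * U) (1 / 10),
          ∀ β : ℝ, 1 ≤ β → β ≤ Real.exp (a / U) →
            ∃ μ ∈ Set.Icc μ₁ μ₂, ∀ ε : ℝ, 0 < ε → ∃ L₀ : ℕ, ∀ (L : ℕ) [NeZero L], L₀ ≤ L →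
              (((hubbardTorus 2 L 1 U - ((g / (L : ℝ) ^ 2 : ℝ) : ℂ) •
                ((pairField dWaveFormFactor L)ᴴ * pairField dWaveFormFactor L))).minEnergyOn
                  (szSector (Λ := FermionTorus 2 L) (2 * ⌊(1 - δ) * (L : ℝ) ^ 2 / 2⌋₊) 0) / (L : ℝ) ^ 2) +
                (Real.log (Matrix.partitionFn β (hubbardTorusWith 2 L 1 U μ - ((g / (L : ℝ) ^ 2 : ℝ) : ℂ) •
                  ((pairField dWaveFormFactor L)ᴴ * pairField dWaveFormFactor L))).re / (β * (L : ℝ) ^ 2)) -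
                μ * ((2 * ⌊(1 - δ) * (L : ℝ) ^ 2 / 2⌋₊) : ℝ) / (L : ℝ) ^ 2 ≤ A β + ε) := by
  intro H
  set c := 2 / β₀ * Real.log (1 + Real.exp (-(8 * β₀))) - A β₀ with hc
  have hcpos : 0 < c := by rw [hc]; linarith
  have hδ : (1/10 : ℝ) ∈ Set.Icc (1/10 : ℝ) (2/5 : ℝ) := ⟨le_rfl, by norm_num⟩
  obtain ⟨μ₁, μ₂, hμ₁, hμ₁₂, hμ₂, a, K', U₀, ha, hK', hU₀, hU⟩ := H (1/10) hδ
  have hlog : 0 ≤ Real.log β₀ := Real.log_nonneg hβ₀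
  have hlog1 : 0 < Real.log β₀ + 1 := by linarith
  -- the witness coupling
  set U : ℝ := min U₀ (min (c / 4) (min (c / (128 * K')) (min (1 / (10 * K')) (a / (Real.log β₀ + 1)))))
    with hUdef
  have hUpos : 0 < U := by
    rw [hUdef]
    refine lt_min hU₀ (lt_min (by positivity) (lt_min (by positivity) (lt_min (by positivity) (by positivity))))
  have hUU₀ : U ≤ U₀ := min_le_left _ _
  have hUc : U ≤ c / 4 := (min_le_right _ _).trans (min_le_left _ _)
  have hUcK : U ≤ c / (128 * K') := (min_le_right _ _).trans ((min_le_right _ _).trans (min_le_left _ _))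
  have hUK : U ≤ 1 / (10 * K') :=
    (min_le_right _ _).trans ((min_le_right _ _).trans ((min_le_right _ _).trans (min_le_left _ _)))
  have hUa : U ≤ a / (Real.log β₀ + 1) :=
    (min_le_right _ _).trans ((min_le_right _ _).trans ((min_le_right _ _).trans (min_le_right _ _)))
  have hUm : U ∈ Set.Ioc (0 : ℝ) U₀ := ⟨hUpos, hUU₀⟩
  -- the witness seed `g = K'U`
  have hg32 : 32 * (K' * U) ≤ c / 4 := by
    have h := mul_le_mul_of_nonneg_left hUcK hK'.le
    have e : K' * (c / (128 * K')) = c / 128 := by field_simp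
    rw [e] at h
    linarith
  have hgm : K' * U ∈ Set.Icc (K' * U) (1 / 10) := by
    refine ⟨le_rfl, ?_⟩
    have h := mul_le_mul_of_nonneg_left hUK hK'.le
    have e : K' * (1 / (10 * K')) = 1 / 10 := by field_simp
    linarith [h, e.le, e.ge]
  -- the witness temperature `β₀ ≤ e^{a/U}`
  have hβexp : β₀ ≤ Real.exp (a / U) := by
    have h1 : Real.log β₀ ≤ a / U := by
      rw [le_div_iff₀ hUpos]
      have h2 : U * (Real.log β₀ + 1) ≤ a := by
        have := mul_le_mul_of_nonneg_right hUa hlog1.le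
        rwa [div_mul_cancel₀ _ hlog1.ne'] at this
      nlinarith
    calc β₀ = Real.exp (Real.log β₀) := (Real.exp_log (lt_of_lt_of_le one_pos hβ₀)).symm
      _ ≤ Real.exp (a / U) := Real.exp_le_exp.2 h1
  obtain ⟨μ, hμm, hμ⟩ := hU U hUm (K' * U) hgm β₀ hβ₀ hβexp
  obtain ⟨L₀, hL₀⟩ := hμ (c / 4) (by positivity)
  haveI : NeZero (max L₀ 3) := ⟨by omega⟩
  have hinst := hL₀ (max L₀ 3) (le_max_left _ _)
  have hμabs : |μ| ≤ 4 := by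
    rw [abs_le]; constructor <;> linarith [hμm.1, hμm.2]
  have hfloor := seeded_defect_floor_crux (max L₀ 3) (le_max_right _ _) (U := U) (g := K' * U)
    (δ := 1/10) hUpos.le (mul_nonneg hK'.le hUpos.le) (lt_of_lt_of_le one_pos hβ₀) hμabs (by norm_num)
  change _ ≤ A β₀ + c / 4 at hinst
  linarith

/-- **The entropy allowance is load-bearing for the repaired crux** (`_false_without_allowance`):
`TwSeededEnsembleEquivalenceR` with `log 4/β` dropped (right-hand side `ε` alone) is FALSE. Any proof must
spend the allowance — there is no "exact" thermal-window ensemble equivalence `D_L → 0` to aim for. -/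
theorem twSeededEnsembleEquivalenceR_false_without_allowance :
    ¬ (∀ δ ∈ Set.Icc (1/10 : ℝ) (2/5 : ℝ), ∃ μ₁ μ₂ : ℝ, -4 < μ₁ ∧ μ₁ ≤ μ₂ ∧ μ₂ < 0 ∧
        ∃ a K' U₀ : ℝ, 0 < a ∧ 0 < K' ∧ 0 < U₀ ∧ ∀ U ∈ Set.Ioc (0 : ℝ) U₀, ∀ g ∈ Set.Icc (K' * U) (1 / 10),
          ∀ β : ℝ, 1 ≤ β → β ≤ Real.exp (a / U) →
            ∃ μ ∈ Set.Icc μ₁ μ₂, ∀ ε : ℝ, 0 < ε → ∃ L₀ : ℕ, ∀ (L : ℕ) [NeZero L], L₀ ≤ L →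
              (((hubbardTorus 2 L 1 U - ((g / (L : ℝ) ^ 2 : ℝ) : ℂ) •
                ((pairField dWaveFormFactor L)ᴴ * pairField dWaveFormFactor L))).minEnergyOn
                  (szSector (Λ := FermionTorus 2 L) (2 * ⌊(1 - δ) * (L : ℝ) ^ 2 / 2⌋₊) 0) / (L : ℝ) ^ 2) +
                (Real.log (Matrix.partitionFn β (hubbardTorusWith 2 L 1 U μ - ((g / (L : ℝ) ^ 2 : ℝ) : ℂ) •
                  ((pairField dWaveFormFactor L)ᴴ * pairField dWaveFormFactor L))).re / (β * (L : ℝ) ^ 2)) -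
                μ * ((2 * ⌊(1 - δ) * (L : ℝ) ^ 2 / 2⌋₊) : ℝ) / (L : ℝ) ^ 2 ≤ ε) := by
  intro H
  refine twSeededEnsembleEquivalenceR_false_of_allowance_lt (fun _ => 0) le_rfl ?_ ?_
  · have : 0 < Real.log (1 + Real.exp (-(8 * (1 : ℝ)))) :=
      Real.log_pos (by linarith [Real.exp_pos (-(8 * (1:ℝ)))])
    positivity
  · intro δ hδ
    obtain ⟨μ₁, μ₂, hμ₁, hμ₁₂, hμ₂, a, K', U₀, ha, hK', hU₀, hU⟩ := H δ hδ
    refine ⟨μ₁, μ₂, hμ₁, hμ₁₂, hμ₂, a, K', U₀, ha, hK', hU₀, fun U hUm g hg β hβ hβa => ?_⟩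
    obtain ⟨μ, hμm, hμ⟩ := hU U hUm g hg β hβ hβa
    refine ⟨μ, hμm, fun ε hε => ?_⟩
    obtain ⟨L₀, hL₀⟩ := hμ ε hε
    exact ⟨L₀, fun L _ hL => by simpa only [zero_add] using hL₀ L hL⟩

end

end Summit.HubbardSuperconductivity.HubbardSuperconductivity.Theorems.TwSeededEnsembleEquivalenceR.Negative
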